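import Summits.AtomisticToContinuum.Crystallization.Theorems.ChartedZeroExcessLayeredLatticeLiouvilleZZZYRCXRT

/-!
# ChartedZeroExcessLayeredLatticeLiouville · ZZZYRCXRVA — ONE OUT-SLAB DECODED ON AN ARBITRARY LETTER WINDOW (§15: the sub-window twins of
RCXRA §11 and of RCXRT's block table lemma)
(decomp-a2c lens-2 g101; binder stmt-AtomisticToContinuum-26636, line (D) kernel production; critic r1907 (B3) lemma (L2), first half; consumer =
ZZZYRCXRV's `kernelSlabSoundOn_of_blocks` and hand-1 g56's half-word unit files, which run RCXRK `slabAccO` on the SUB-WINDOW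
`[600 + H₀, 600 + 2H₀]` (upper half-word) resp. `[600, 600 + H₀]` (lower half-word).)

RCXRA/RCXRT read the out kernel's soundness (RCXRS `slabAccO_sound`, valid for EVERY admissible letter assignment of ANY window) only at the
window of record `[600, 600 + 2H₀]` through `admO_rhoOf`.  This file states the same four lemmas for a run on an arbitrary window
`[wlo, whi] ∋ 600 + H₀` with letters `win'`, under the hypothesis `hρ : AdmO win' wlo whi (rhoOf ℓ)` in place of window agreement:
`slab_validO'`, ★ `slab_thetaR0G_le'`, ★ `slab_thetaN0G_le'` (proofs verbatim from RCXRA with `admO_rhoOf hℓ hwl hag ↦ hρ`,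
`inWin_base H₀ ↦ hX`), and `thetaG_outData_le'` (from RCXRT).  Imports RCXRT; 0 sorry.  All `[folklore]`.
-/

namespace Summit.AtomisticToContinuum.Crystallization.Theorems.ChartedZeroExcessLayeredLatticeLiouville.ThetaKernel

open scoped BigOperators

/-! ## §15 one slab decoded on an arbitrary letter window -/

section SubSlab

variable {win' : List ℕ} {wlo whi H₀ P9 E : ℕ} {lo hi : ℤ} {t0 : PT} {cs : List (List ℕ)} {T : List (ℕ × ℕ × ℕ)} {ℓ : ℤ → ℤ}

/-- RCXRA `slab_validO` — the guarded piece clause (V) — for a run on ANY window `[wlo, whi] ∋ 600 + H₀` under an admissible `rhoOf ℓ`. [folklore] -/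
theorem slab_validO' (hℓ : IsLetterSeq ℓ) (hρ : AdmO win' wlo whi (rhoOf ℓ)) (hX : inWin wlo whi (600 + H₀) = true) (hH : H₀ < 601)
    (hne : ∀ c ∈ cs, c ≠ []) (h : slabAccO win' wlo whi (600 + H₀) P9 E lo hi t0 cs = some T) :
    ∀ c' ∈ cs.map (decodeChord H₀), IsCenterBased H₀ c'.1 ∧
      (lo < n9F ℓ c'.1 → n9F ℓ c'.1 ≤ hi → ∀ i < chordNp c', 0 < n9F ℓ (chordPiece c' i) ∧ n9F ℓ (chordPiece c' i) ≤ (P9 : ℤ)) := by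
  intro c' hc'
  obtain ⟨c, hc, rfl⟩ := List.mem_map.mp hc'
  obtain ⟨H1, -, -⟩ := slabAccO_sound hρ hX (by omega) t0 cs T h
  refine ⟨⟨rfl, rfl⟩, fun hlo hhi i hi' => ?_⟩
  rw [n9F_decodeChord_fst_rho hℓ] at hlo hhi
  rw [chordNp_decodeChord H₀ (hne c hc)] at hi'
  rw [chordPiece_decodeChord H₀ (hne c hc) i, n9F_liftN_rho hℓ]
  obtain ⟨-, -, -, h0, hP⟩ := H1 c hc ⟨hlo, hhi⟩ _ (nodePiece_mem_piecesFrom c (chordX H₀) (dec3 (lastD c 0)) hi')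
  exact ⟨h0, hP⟩

/-- ★★ RCXRA `slab_thetaR0G_le` for a run on ANY window `[wlo, whi] ∋ 600 + H₀` under an admissible `rhoOf ℓ`: the guarded R table of the
decoded slab at any raw key `k` is at most the kernel table's key-wise R sum at `codeKO k`, read at exponent `E` (`lo ≥ 0`). [folklore] -/
theorem slab_thetaR0G_le' (hℓ : IsLetterSeq ℓ) (hρ : AdmO win' wlo whi (rhoOf ℓ)) (hX : inWin wlo whi (600 + H₀) = true) (hH : H₀ < 601)
    (hP9 : P9 ≤ 2000000) (hlo : 0 ≤ lo) (hne : ∀ c ∈ cs, c ≠ [])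
    (h : slabAccO win' wlo whi (600 + H₀) P9 E lo hi t0 cs = some T) (k : ℤ × ℤ × ℤ × ℤ) :
    thetaR0G ℓ lo hi (cs.map (decodeChord H₀)) k ≤ (tabR T (codeKO k) : ℝ) / 2 ^ E := by
  obtain ⟨H1, H2, -⟩ := slabAccO_sound hρ hX (by omega) t0 cs T h
  have hpow : (0 : ℝ) < 2 ^ E := by positivity
  set ρ := rhoOf ℓ with hρdef
  -- per chord
  have hchord : ∀ c ∈ cs, (if lo < n9F ℓ (decodeChord H₀ c).1 ∧ n9F ℓ (decodeChord H₀ c).1 ≤ hi then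
      ∑ i ∈ Finset.range (chordNp (decodeChord H₀ c)),
        (if pieceKeyF (chordPiece (decodeChord H₀ c) i) = k then coefR0F ℓ (decodeChord H₀ c) else 0) else 0) ≤
      (chordRO ρ (2 ^ E * 45927) (600 + H₀) lo hi c (codeKO k) : ℝ) / 2 ^ E := by
    intro c hc
    have hcn := hne c hc
    rw [n9F_decodeChord_fst_rho hℓ]
    by_cases hr : inRangeO ρ (600 + H₀) lo hi c
    · have hr' : lo < n9Z (chordEO (rhoOf ℓ) (600 + H₀) c) ∧ n9Z (chordEO (rhoOf ℓ) (600 + H₀) c) ≤ hi := hr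
      rw [if_pos hr']
      unfold chordRO
      rw [if_pos hr]
      have hu : 0 < n9Z (chordEO ρ (600 + H₀) c) := lt_of_le_of_lt hlo hr'.1
      have hpieces := H1 c hc hr
      rw [chordNp_decodeChord H₀ hcn, Finset.sum_congr rfl fun i _ => by rw [chordPiece_decodeChord H₀ hcn i],
        ← sum_map_piecesFrom (fun pr => if pieceKeyF (liftN pr) = k then coefR0F ℓ (decodeChord H₀ c) else 0)
          (dec3 (lastD c 0)) c (chordX H₀), cast_sum_filter_div', ← chordXO_eq]
      refine List.sum_le_sum fun pr hpr => ?_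
      obtain ⟨-, -, -, h0, hP⟩ := hpieces pr hpr
      obtain ⟨o1, -, o2, -, o3, -⟩ := piece_offsetsL hρ.2 hP9 pr hP
      by_cases hk : pieceKeyF (liftN pr) = k
      · have hq : keyOf pr = codeKO k := by rw [keyOf_eq_codeKO pr o1 o2 o3, hk]
        simp only [hk, hq, if_true]
        exact coefR0F_le_rho hℓ hcn hu
      · simp only [hk, if_false]
        split_ifs <;> positivity
    · have hr' : ¬ (lo < n9Z (chordEO (rhoOf ℓ) (600 + H₀) c) ∧ n9Z (chordEO (rhoOf ℓ) (600 + H₀) c) ≤ hi) := hr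
      rw [if_neg hr']
      positivity
  -- sum over chords
  unfold thetaR0G
  rw [List.map_map]
  calc ((cs.map ((fun c => if lo < n9F ℓ c.1 ∧ n9F ℓ c.1 ≤ hi then ∑ i ∈ Finset.range (chordNp c),
          (if pieceKeyF (chordPiece c i) = k then coefR0F ℓ c else 0) else 0) ∘ decodeChord H₀))).sum
      ≤ (cs.map fun c => (chordRO ρ (2 ^ E * 45927) (600 + H₀) lo hi c (codeKO k) : ℝ) / 2 ^ E).sum :=
        List.sum_le_sum fun c hc => hchord c hc
    _ = ((cs.map fun c => chordRO ρ (2 ^ E * 45927) (600 + H₀) lo hi c (codeKO k)).sum : ℕ) / 2 ^ E := by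
        rw [Nat.cast_list_sum, List.map_map, div_eq_mul_inv, ← List.sum_map_mul_right]
        rfl
    _ ≤ (tabR T (codeKO k) : ℝ) / 2 ^ E := by
        gcongr
        exact_mod_cast H2 (codeKO k)

/-- ★★ RCXRA `slab_thetaN0G_le` for a run on ANY window `[wlo, whi] ∋ 600 + H₀` under an admissible `rhoOf ℓ`: likewise for `thetaN0G` and the
key-wise N sums. [folklore] -/
theorem slab_thetaN0G_le' (hℓ : IsLetterSeq ℓ) (hρ : AdmO win' wlo whi (rhoOf ℓ)) (hX : inWin wlo whi (600 + H₀) = true) (hH : H₀ < 601)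
    (hP9 : P9 ≤ 2000000) (hlo : 0 ≤ lo) (hne : ∀ c ∈ cs, c ≠ [])
    (h : slabAccO win' wlo whi (600 + H₀) P9 E lo hi t0 cs = some T) (k : ℤ × ℤ × ℤ × ℤ) :
    thetaN0G ℓ lo hi (cs.map (decodeChord H₀)) k ≤ (tabN T (codeKO k) : ℝ) / 2 ^ E := by
  obtain ⟨H1, -, H3⟩ := slabAccO_sound hρ hX (by omega) t0 cs T h
  have hpow : (0 : ℝ) < 2 ^ E := by positivity
  set ρ := rhoOf ℓ with hρdef
  have hchord : ∀ c ∈ cs, (if lo < n9F ℓ (decodeChord H₀ c).1 ∧ n9F ℓ (decodeChord H₀ c).1 ≤ hi then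
      ∑ i ∈ Finset.range (chordNp (decodeChord H₀ c)),
        (if pieceKeyF (chordPiece (decodeChord H₀ c) i) = k then coefN0F ℓ (decodeChord H₀ c) i else 0) else 0) ≤
      (chordNO ρ (2 ^ E * 45927) (600 + H₀) lo hi c (codeKO k) : ℝ) / 2 ^ E := by
    intro c hc
    have hcn := hne c hc
    rw [n9F_decodeChord_fst_rho hℓ]
    by_cases hr : inRangeO ρ (600 + H₀) lo hi c
    · have hr' : lo < n9Z (chordEO (rhoOf ℓ) (600 + H₀) c) ∧ n9Z (chordEO (rhoOf ℓ) (600 + H₀) c) ≤ hi := hr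
      rw [if_pos hr']
      unfold chordNO
      rw [if_pos hr]
      have hu : 0 < n9Z (chordEO ρ (600 + H₀) c) := lt_of_le_of_lt hlo hr'.1
      have hpieces := H1 c hc hr
      simp only [coefN0F_eq_coefNpieceF]
      rw [chordNp_decodeChord H₀ hcn, Finset.sum_congr rfl fun i _ => by rw [chordPiece_decodeChord H₀ hcn i],
        ← sum_map_piecesFrom (fun pr => if pieceKeyF (liftN pr) = k then coefNpieceF ℓ (decodeChord H₀ c) (liftN pr) else 0)
          (dec3 (lastD c 0)) c (chordX H₀), cast_sum_filter_div', ← chordXO_eq]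
      refine List.sum_le_sum fun pr hpr => ?_
      obtain ⟨-, -, -, h0, hP⟩ := hpieces pr hpr
      obtain ⟨o1, -, o2, -, o3, -⟩ := piece_offsetsL hρ.2 hP9 pr hP
      by_cases hk : pieceKeyF (liftN pr) = k
      · have hq : keyOf pr = codeKO k := by rw [keyOf_eq_codeKO pr o1 o2 o3, hk]
        simp only [hk, hq, if_true]
        exact coefNpieceF_le_rho hℓ hcn hu h0
      · simp only [hk, if_false]
        split_ifs <;> positivity
    · have hr' : ¬ (lo < n9Z (chordEO (rhoOf ℓ) (600 + H₀) c) ∧ n9Z (chordEO (rhoOf ℓ) (600 + H₀) c) ≤ hi) := hr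
      rw [if_neg hr']
      positivity
  unfold thetaN0G
  rw [List.map_map]
  calc ((cs.map ((fun c => if lo < n9F ℓ c.1 ∧ n9F ℓ c.1 ≤ hi then ∑ i ∈ Finset.range (chordNp c),
          (if pieceKeyF (chordPiece c i) = k then coefN0F ℓ c i else 0) else 0) ∘ decodeChord H₀))).sum
      ≤ (cs.map fun c => (chordNO ρ (2 ^ E * 45927) (600 + H₀) lo hi c (codeKO k) : ℝ) / 2 ^ E).sum :=
        List.sum_le_sum fun c hc => hchord c hc
    _ = ((cs.map fun c => chordNO ρ (2 ^ E * 45927) (600 + H₀) lo hi c (codeKO k)).sum : ℕ) / 2 ^ E := by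
        rw [Nat.cast_list_sum, List.map_map, div_eq_mul_inv, ← List.sum_map_mul_right]
        rfl
    _ ≤ (tabN T (codeKO k) : ℝ) / 2 ^ E := by
        gcongr
        exact_mod_cast H3 (codeKO k)

end SubSlab

section SubBlocks

variable {win' : List ℕ} {wlo whi H₀ P9 E lo hi : ℕ} {yms : List ℕ} {t0 : ℕ → PT} {cs : ℕ → List (List ℕ)} {T : ℕ → List (ℕ × ℕ × ℕ)}
  {ℓ : ℤ → ℤ}

/-- RCXRT `thetaG_outData_le` for a group of blocks run on ANY window `[wlo, whi] ∋ 600 + H₀` under an admissible `rhoOf ℓ`: the guarded tables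
of the decoded group data are dominated block by block by the summed integer tables. [folklore] -/
theorem thetaG_outData_le' (hℓ : IsLetterSeq ℓ) (hρ : AdmO win' wlo whi (rhoOf ℓ)) (hX : inWin wlo whi (600 + H₀) = true) (hH : H₀ < 601)
    (hP9 : P9 ≤ 2000000)
    (hblk : ∀ ym ∈ yms, slabAccO win' wlo whi (600 + H₀) P9 E (lo : ℤ) (hi : ℤ) (t0 ym) (cs ym) = some (T ym) ∧
      nonemptyAll (cs ym) = true) :
    ∀ (l : List ℕ), (∀ ym ∈ l, ym ∈ yms) → ∀ k,
      thetaR0G ℓ lo hi (outData H₀ l cs) k ≤ (outTR l T k : ℝ) / 2 ^ E ∧ thetaN0G ℓ lo hi (outData H₀ l cs) k ≤ (outTN l T k : ℝ) / 2 ^ E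
  | [], _, k => by simp [outData, outTR, outTN, thetaR0G, thetaN0G]
  | ym :: rest, hl, k => by
    have hym := hblk ym (hl ym List.mem_cons_self)
    have hne := ne_nil_of_nonemptyAll hym.2
    obtain ⟨ihR, ihN⟩ := thetaG_outData_le' hℓ hρ hX hH hP9 hblk rest (fun y hy => hl y (List.mem_cons_of_mem _ hy)) k
    have hsplit : outData H₀ (ym :: rest) cs = (cs ym).map (decodeChord H₀) ++ outData H₀ rest cs := by
      simp [outData, List.flatMap_cons]
    obtain ⟨eR, eN⟩ := thetaG_append ℓ lo hi ((cs ym).map (decodeChord H₀)) (outData H₀ rest cs) k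
    have hR := slab_thetaR0G_le' hℓ hρ hX hH hP9 (by positivity) hne hym.1 k
    have hN := slab_thetaN0G_le' hℓ hρ hX hH hP9 (by positivity) hne hym.1 k
    rw [hsplit, eR, eN]
    simp only [outTR, outTN, List.map_cons, List.sum_cons, Int.cast_add, Int.cast_natCast] at ihR ihN ⊢
    rw [add_div, add_div]
    exact ⟨add_le_add hR ihR, add_le_add hN ihN⟩

end SubBlocks

end Summit.AtomisticToContinuum.Crystallization.Theorems.ChartedZeroExcessLayeredLatticeLiouville.ThetaKernel
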